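import Mathlib.Analysis.Convex.Deriv
import Mathlib.Analysis.SpecialFunctions.Log.Deriv
import Mathlib.Analysis.SpecialFunctions.ExpDeriv
import Mathlib.Analysis.SpecialFunctions.Pow.Real
import HarnessLib

/-!
# The port component of `(Q6)` along ONE EDGE WEIGHT: convexity of `Q³/(I_aI_b)^{3/2}` under the decrement condition `X ≥ S`

Support file for crux `stmt-CriticalPhenomena-4575` (`NoHeavyLowerTail`), seat `prim-l12-p1` gen 22
(`--supports stmt-CriticalPhenomena-4575`; memo `run/shared/lean/prim/prim-l12/FROM-prim-l12-p1-g22-CHALF-ALL-GRAPHS.md` §8,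
proof text `prim-l12-p1/PROOF-CHALF-ALL-GRAPHS-gen22.md`).  No definitions, no sorries, standard axioms.  Law-level (real-analysis) shell of
the ALL-GRAPHS theorem of the memo: `(Q6)_port`, hence `(C½)`, for every finite weighted graph, by induction on the number of positive pairs.

Fix three terminals `a, b, c` of a finite weighted graph and ONE pair `e = {c, w}` at the port `c` (`w ∉ {a,b,c}`); let `r ∈ [0,1]` be its
weight, all other weights fixed.  The isolation coordinates are AFFINE in `r`:
`Q(r) = P(a|b|c) = q₀ − r·dq`, `I_a(r) = P(a ∤ {b,c}) = a₀ − r·da`, `I_b(r) = b₀ − r·db`, `I_c(r) = c₀ − r·dc` (decrements `≥ 0`;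
`r = 0` is the graph without `e`, `r = 1` the graph with `c, w` identified).  THIS FILE (pure real analysis, generalising
`ThreePointIsoSexticPendantConvex`, which is the case `a₀ = b₀ = q₀`, `c₀ = 1`, `dq = da + db`):

* `onePair_key` — with `X = dq/Q(r)`, `A = da/I_a(r)`, `B = db/I_b(r)`: `φ'' + φ'² = ¾(A−B)² + 3(X−S)(2X−S)`, `S = A+B`, hence `≥ 0` as soon as
  **`X ≥ S`**, i.e. `dq·I_a(r)·I_b(r) ≥ Q(r)·(da·I_b(r) + db·I_a(r))` (the DECREMENT CONDITION `XS` of the memo: the Harris ratio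
  `Q/(I_aI_b)` is non-increasing in `r`);
* `convexOn_onePair` — under `XS` on `[0,1]`, `Φ(r) = Q(r)³/(I_a(r)I_b(r))^{3/2} = exp φ(r)` is CONVEX on `[0,1]`;
* `sextic_onePair` — **if `(Q6)_c` holds at `r = 0` and at `r = 1` (`q₀⁶ ≤ a₀³b₀³c₀²`, `(q₀−dq)⁶ ≤ (a₀−da)³(b₀−db)³(c₀−dc)²`) and `XS` holds on
  `[0,1]`, then `(Q6)_c` holds for every `r ∈ [0,1]`**: `Q(r)⁶ ≤ I_a(r)³I_b(r)³I_c(r)²` (chord of the convex `Φ` below the affine `I_c`);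
* `xs_of_termwise` — `XS` on `[0,1]` follows from the two TERMWISE inequalities `dq_a·I_a(r) ≥ da·Q(r)`, `dq_b·I_b(r) ≥ db·Q(r)`
  (`dq = dq_a + dq_b`), which are affine in `r`, so from their values at `r = 0` and `r = 1` — in the graph these four endpoint
  inequalities are the cluster-correlation inequalities NC₀/NC₁ of the memo, consequences of van den Berg–Häggström–Kahn 2006 Thm 1.3
  (`BHK2006_clusterConditionalPositiveAssociation` with `X = {b,c}`).
The graph-level assembly (affine decomposition in one weight, Markov property given `C_a`, induction over quotient graphs) is the next file.
-/

namespace Summit.CriticalPhenomena.PercolationContinuityZ3.Theorems.ThreePointIsoSexticOnePair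

open Set Real

/-! ## Calculus along the weight of one pair -/

/-- Derivative of `φ(r) = 3 log(q₀ − r·dq) − 3/2 log(a₀ − r·da) − 3/2 log(b₀ − r·db)`. [this work] -/
theorem hasDerivAt_phi {q₀ dq a₀ da b₀ db r : ℝ} (h1 : q₀ - r * dq ≠ 0) (h2 : a₀ - r * da ≠ 0) (h3 : b₀ - r * db ≠ 0) :
    HasDerivAt (fun r => 3 * log (q₀ - r * dq) - 3 / 2 * log (a₀ - r * da) - 3 / 2 * log (b₀ - r * db))
      (3 * (-dq / (q₀ - r * dq)) - 3 / 2 * (-da / (a₀ - r * da)) - 3 / 2 * (-db / (b₀ - r * db))) r := by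
  have e1 : HasDerivAt (fun r => q₀ - r * dq) (-dq) r := (hasDerivAt_mul_const dq).const_sub q₀
  have e2 : HasDerivAt (fun r => a₀ - r * da) (-da) r := (hasDerivAt_mul_const da).const_sub a₀
  have e3 : HasDerivAt (fun r => b₀ - r * db) (-db) r := (hasDerivAt_mul_const db).const_sub b₀
  exact (((e1.log h1).const_mul 3).fun_sub ((e2.log h2).const_mul (3 / 2))).fun_sub ((e3.log h3).const_mul (3 / 2))

/-- Derivative of `φ'`. [this work] -/
theorem hasDerivAt_phi1 {q₀ dq a₀ da b₀ db r : ℝ} (h1 : q₀ - r * dq ≠ 0) (h2 : a₀ - r * da ≠ 0) (h3 : b₀ - r * db ≠ 0) :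
    HasDerivAt (fun r => 3 * (-dq / (q₀ - r * dq)) - 3 / 2 * (-da / (a₀ - r * da)) - 3 / 2 * (-db / (b₀ - r * db)))
      (3 * (-dq ^ 2 / (q₀ - r * dq) ^ 2) - 3 / 2 * (-da ^ 2 / (a₀ - r * da) ^ 2)
        - 3 / 2 * (-db ^ 2 / (b₀ - r * db) ^ 2)) r := by
  have e1 : HasDerivAt (fun r => q₀ - r * dq) (-dq) r := (hasDerivAt_mul_const dq).const_sub q₀
  have e2 : HasDerivAt (fun r => a₀ - r * da) (-da) r := (hasDerivAt_mul_const da).const_sub a₀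
  have e3 : HasDerivAt (fun r => b₀ - r * db) (-db) r := (hasDerivAt_mul_const db).const_sub b₀
  have d1 : HasDerivAt (fun r => -dq / (q₀ - r * dq)) (-dq ^ 2 / (q₀ - r * dq) ^ 2) r := by
    have h0 := (hasDerivAt_const r (-dq)).fun_div e1 h1
    simp only [zero_mul, zero_sub] at h0
    refine h0.congr_deriv ?_
    ring
  have d2 : HasDerivAt (fun r => -da / (a₀ - r * da)) (-da ^ 2 / (a₀ - r * da) ^ 2) r := by
    have h0 := (hasDerivAt_const r (-da)).fun_div e2 h2
    simp only [zero_mul, zero_sub] at h0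
    refine h0.congr_deriv ?_
    ring
  have d3 : HasDerivAt (fun r => -db / (b₀ - r * db)) (-db ^ 2 / (b₀ - r * db) ^ 2) r := by
    have h0 := (hasDerivAt_const r (-db)).fun_div e3 h3
    simp only [zero_mul, zero_sub] at h0
    refine h0.congr_deriv ?_
    ring
  exact ((d1.const_mul 3).fun_sub (d2.const_mul (3 / 2))).fun_sub (d3.const_mul (3 / 2))

/-- **The key identity and sign.**  With `X = dq/Q`, `A = da/I_a`, `B = db/I_b` (`Q = q₀ − r·dq > 0` etc.):
`φ'' + φ'² = ¾(A−B)² + 3(X−S)(2X−S)`, `S = A + B`; hence `φ'' + φ'² ≥ 0` under the decrement condition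
`XS : dq·I_a·I_b ≥ Q·(da·I_b + db·I_a)` (i.e. `S ≤ X`) and `dq ≥ 0`. [this work] -/
theorem onePair_key {q₀ dq a₀ da b₀ db r : ℝ} (hQ : 0 < q₀ - r * dq) (hA : 0 < a₀ - r * da) (hB : 0 < b₀ - r * db)
    (hdq : 0 ≤ dq) (hXS : (q₀ - r * dq) * (da * (b₀ - r * db) + db * (a₀ - r * da)) ≤ dq * (a₀ - r * da) * (b₀ - r * db)) :
    0 ≤ (3 * (-dq / (q₀ - r * dq)) - 3 / 2 * (-da / (a₀ - r * da)) - 3 / 2 * (-db / (b₀ - r * db))) ^ 2 +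
      (3 * (-dq ^ 2 / (q₀ - r * dq) ^ 2) - 3 / 2 * (-da ^ 2 / (a₀ - r * da) ^ 2)
        - 3 / 2 * (-db ^ 2 / (b₀ - r * db) ^ 2)) := by
  set X : ℝ := dq / (q₀ - r * dq) with hX
  set A : ℝ := da / (a₀ - r * da) with hAdef
  set B : ℝ := db / (b₀ - r * db) with hBdef
  have eX : -dq / (q₀ - r * dq) = -X := by rw [hX, neg_div]
  have eA : -da / (a₀ - r * da) = -A := by rw [hAdef, neg_div]
  have eB : -db / (b₀ - r * db) = -B := by rw [hBdef, neg_div]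
  have eX2 : -dq ^ 2 / (q₀ - r * dq) ^ 2 = -X ^ 2 := by rw [hX, neg_div, div_pow]
  have eA2 : -da ^ 2 / (a₀ - r * da) ^ 2 = -A ^ 2 := by rw [hAdef, neg_div, div_pow]
  have eB2 : -db ^ 2 / (b₀ - r * db) ^ 2 = -B ^ 2 := by rw [hBdef, neg_div, div_pow]
  rw [eX, eA, eB, eX2, eA2, eB2]
  have hX0 : 0 ≤ X := div_nonneg hdq hQ.le
  -- `A + B ≤ X` from `XS`
  have hS : A + B ≤ X := by
    rw [hX, hAdef, hBdef, div_add_div _ _ hA.ne' hB.ne', div_le_div_iff₀ (mul_pos hA hB) hQ]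
    calc (da * (b₀ - r * db) + (a₀ - r * da) * db) * (q₀ - r * dq)
        = (q₀ - r * dq) * (da * (b₀ - r * db) + db * (a₀ - r * da)) := by ring
      _ ≤ dq * (a₀ - r * da) * (b₀ - r * db) := hXS
      _ = dq * ((a₀ - r * da) * (b₀ - r * db)) := by ring
  have key : (3 * -X - 3 / 2 * -A - 3 / 2 * -B) ^ 2 + (3 * -X ^ 2 - 3 / 2 * -A ^ 2 - 3 / 2 * -B ^ 2) =
      3 / 4 * (A - B) ^ 2 + 3 * ((X - (A + B)) * (2 * X - (A + B))) := by ring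
  rw [key]
  have h4 : 0 ≤ (X - (A + B)) * (2 * X - (A + B)) := mul_nonneg (by linarith) (by linarith)
  positivity

/-- **Convexity of `Φ(r) = Q(r)³/(I_a(r)I_b(r))^{3/2}` on `[0,1]` under the decrement condition `XS`** (written `Φ = exp ∘ φ`).
Hypotheses: the three affine functions are positive at both ends, `dq ≥ 0`, and `XS` at every `r ∈ [0,1]`. [this work] -/
theorem convexOn_onePair {q₀ dq a₀ da b₀ db : ℝ} (hq0 : 0 < q₀) (hq1 : 0 < q₀ - dq) (ha0 : 0 < a₀) (ha1 : 0 < a₀ - da)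
    (hb0 : 0 < b₀) (hb1 : 0 < b₀ - db) (hdq : 0 ≤ dq)
    (hXS : ∀ r ∈ Icc (0 : ℝ) 1, (q₀ - r * dq) * (da * (b₀ - r * db) + db * (a₀ - r * da)) ≤ dq * (a₀ - r * da) * (b₀ - r * db)) :
    ConvexOn ℝ (Icc (0 : ℝ) 1)
      (fun r => exp (3 * log (q₀ - r * dq) - 3 / 2 * log (a₀ - r * da) - 3 / 2 * log (b₀ - r * db))) := by
  have pos : ∀ r ∈ Icc (0 : ℝ) 1, 0 < q₀ - r * dq ∧ 0 < a₀ - r * da ∧ 0 < b₀ - r * db := by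
    intro r hr
    obtain ⟨hr0, hr1⟩ := hr
    have affine_pos : ∀ {x0 x1 : ℝ}, 0 < x0 → 0 < x1 → 0 < (1 - r) * x0 + r * x1 := by
      intro x0 x1 h0 h1
      rcases le_or_gt r (1 / 2) with h | h
      · have : 0 ≤ r * x1 := mul_nonneg hr0 h1.le
        nlinarith
      · have : 0 ≤ (1 - r) * x0 := mul_nonneg (sub_nonneg.2 hr1) h0.le
        nlinarith
    refine ⟨?_, ?_, ?_⟩
    · have : q₀ - r * dq = (1 - r) * q₀ + r * (q₀ - dq) := by ring
      rw [this]; exact affine_pos hq0 hq1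
    · have : a₀ - r * da = (1 - r) * a₀ + r * (a₀ - da) := by ring
      rw [this]; exact affine_pos ha0 ha1
    · have : b₀ - r * db = (1 - r) * b₀ + r * (b₀ - db) := by ring
      rw [this]; exact affine_pos hb0 hb1
  refine convexOn_of_hasDerivWithinAt2_nonneg (convex_Icc 0 1)
    (f' := fun r => exp (3 * log (q₀ - r * dq) - 3 / 2 * log (a₀ - r * da) - 3 / 2 * log (b₀ - r * db)) *
      (3 * (-dq / (q₀ - r * dq)) - 3 / 2 * (-da / (a₀ - r * da)) - 3 / 2 * (-db / (b₀ - r * db))))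
    (f'' := fun r => exp (3 * log (q₀ - r * dq) - 3 / 2 * log (a₀ - r * da) - 3 / 2 * log (b₀ - r * db)) *
      (3 * (-dq / (q₀ - r * dq)) - 3 / 2 * (-da / (a₀ - r * da)) - 3 / 2 * (-db / (b₀ - r * db))) *
      (3 * (-dq / (q₀ - r * dq)) - 3 / 2 * (-da / (a₀ - r * da)) - 3 / 2 * (-db / (b₀ - r * db))) +
      exp (3 * log (q₀ - r * dq) - 3 / 2 * log (a₀ - r * da) - 3 / 2 * log (b₀ - r * db)) *
      (3 * (-dq ^ 2 / (q₀ - r * dq) ^ 2) - 3 / 2 * (-da ^ 2 / (a₀ - r * da) ^ 2)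
        - 3 / 2 * (-db ^ 2 / (b₀ - r * db) ^ 2)))
    ?_ ?_ ?_ ?_
  · intro r hr
    obtain ⟨h1, h2, h3⟩ := pos r hr
    exact ((hasDerivAt_phi h1.ne' h2.ne' h3.ne').exp).continuousAt.continuousWithinAt
  · intro r hr
    rw [interior_Icc] at hr
    obtain ⟨h1, h2, h3⟩ := pos r (Ioo_subset_Icc_self hr)
    exact ((hasDerivAt_phi h1.ne' h2.ne' h3.ne').exp).hasDerivWithinAt
  · intro r hr
    rw [interior_Icc] at hr
    obtain ⟨h1, h2, h3⟩ := pos r (Ioo_subset_Icc_self hr)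
    exact (((hasDerivAt_phi h1.ne' h2.ne' h3.ne').exp).fun_mul (hasDerivAt_phi1 h1.ne' h2.ne' h3.ne')).hasDerivWithinAt
  · intro r hr
    rw [interior_Icc] at hr
    have hr' := Ioo_subset_Icc_self hr
    obtain ⟨h1, h2, h3⟩ := pos r hr'
    have hk := onePair_key h1 h2 h3 hdq (hXS r hr')
    set E := exp (3 * log (q₀ - r * dq) - 3 / 2 * log (a₀ - r * da) - 3 / 2 * log (b₀ - r * db)) with hEdef
    set F1 := 3 * (-dq / (q₀ - r * dq)) - 3 / 2 * (-da / (a₀ - r * da)) - 3 / 2 * (-db / (b₀ - r * db)) with hF1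
    set F2 := 3 * (-dq ^ 2 / (q₀ - r * dq) ^ 2) - 3 / 2 * (-da ^ 2 / (a₀ - r * da) ^ 2)
        - 3 / 2 * (-db ^ 2 / (b₀ - r * db) ^ 2) with hF2
    have hE : 0 ≤ E := (exp_pos _).le
    have e : E * F1 * F1 + E * F2 = E * (F1 ^ 2 + F2) := by ring
    rw [e]
    exact mul_nonneg hE hk

/-- The square of `Φ` is `Q⁶/(I_a³I_b³)`. [this work] -/
theorem Phi_sq {q₀ dq a₀ da b₀ db r : ℝ} (h1 : 0 < q₀ - r * dq) (h2 : 0 < a₀ - r * da) (h3 : 0 < b₀ - r * db) :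
    exp (3 * log (q₀ - r * dq) - 3 / 2 * log (a₀ - r * da) - 3 / 2 * log (b₀ - r * db)) ^ 2 =
      (q₀ - r * dq) ^ 6 / ((a₀ - r * da) ^ 3 * (b₀ - r * db) ^ 3) := by
  rw [← exp_nat_mul]
  have e : ((2 : ℕ) : ℝ) * (3 * log (q₀ - r * dq) - 3 / 2 * log (a₀ - r * da) - 3 / 2 * log (b₀ - r * db)) =
      ((6 : ℕ) : ℝ) * log (q₀ - r * dq) - (((3 : ℕ) : ℝ) * log (a₀ - r * da) + ((3 : ℕ) : ℝ) * log (b₀ - r * db)) := by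
    push_cast; ring
  rw [e, exp_sub, exp_add, exp_nat_mul, exp_nat_mul, exp_nat_mul, exp_log h1, exp_log h2, exp_log h3]

/-- From `Φ(r)² = Q⁶/(I_a³I_b³)` and a bound `Q⁶ ≤ I_a³I_b³C²` (`C ≥ 0`): `Φ(r) ≤ C`. [this work] -/
theorem Phi_le_of_sextic {q₀ dq a₀ da b₀ db r C : ℝ} (h1 : 0 < q₀ - r * dq) (h2 : 0 < a₀ - r * da) (h3 : 0 < b₀ - r * db)
    (hC : 0 ≤ C) (h6 : (q₀ - r * dq) ^ 6 ≤ (a₀ - r * da) ^ 3 * (b₀ - r * db) ^ 3 * C ^ 2) :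
    exp (3 * log (q₀ - r * dq) - 3 / 2 * log (a₀ - r * da) - 3 / 2 * log (b₀ - r * db)) ≤ C := by
  have hD : 0 < (a₀ - r * da) ^ 3 * (b₀ - r * db) ^ 3 := mul_pos (pow_pos h2 3) (pow_pos h3 3)
  have hsq : exp (3 * log (q₀ - r * dq) - 3 / 2 * log (a₀ - r * da) - 3 / 2 * log (b₀ - r * db)) ^ 2 ≤ C ^ 2 := by
    rw [Phi_sq h1 h2 h3, div_le_iff₀ hD]
    calc (q₀ - r * dq) ^ 6 ≤ (a₀ - r * da) ^ 3 * (b₀ - r * db) ^ 3 * C ^ 2 := h6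
      _ = C ^ 2 * ((a₀ - r * da) ^ 3 * (b₀ - r * db) ^ 3) := by ring
  exact (pow_le_pow_iff_left₀ (exp_pos _).le hC two_ne_zero).1 hsq

/-- **`(Q6)_c` along one edge weight.**  If the port component of the sextic law holds at `r = 0` and at `r = 1` and the decrement
condition `XS` holds on `[0,1]`, then the port component holds for every `r ∈ [0,1]`:
`Q(r)⁶ ≤ I_a(r)³·I_b(r)³·I_c(r)²`. [this work] -/
theorem sextic_onePair {q₀ dq a₀ da b₀ db c₀ dc r : ℝ} (hq0 : 0 < q₀) (hq1 : 0 < q₀ - dq) (ha0 : 0 < a₀) (ha1 : 0 < a₀ - da)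
    (hb0 : 0 < b₀) (hb1 : 0 < b₀ - db) (hc0 : 0 ≤ c₀) (hc1 : 0 ≤ c₀ - dc) (hdq : 0 ≤ dq)
    (hXS : ∀ r ∈ Icc (0 : ℝ) 1, (q₀ - r * dq) * (da * (b₀ - r * db) + db * (a₀ - r * da)) ≤ dq * (a₀ - r * da) * (b₀ - r * db))
    (h0 : q₀ ^ 6 ≤ a₀ ^ 3 * b₀ ^ 3 * c₀ ^ 2) (h1 : (q₀ - dq) ^ 6 ≤ (a₀ - da) ^ 3 * (b₀ - db) ^ 3 * (c₀ - dc) ^ 2)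
    (hr0 : 0 ≤ r) (hr1 : r ≤ 1) :
    (q₀ - r * dq) ^ 6 ≤ (a₀ - r * da) ^ 3 * (b₀ - r * db) ^ 3 * (c₀ - r * dc) ^ 2 := by
  -- positivity along the segment
  have affine_pos : ∀ {x0 x1 : ℝ}, 0 < x0 → 0 < x1 → 0 < (1 - r) * x0 + r * x1 := by
    intro x0 x1 h0 h1
    rcases le_or_gt r (1 / 2) with h | h
    · have : 0 ≤ r * x1 := mul_nonneg hr0 h1.le
      nlinarith
    · have : 0 ≤ (1 - r) * x0 := mul_nonneg (sub_nonneg.2 hr1) h0.le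
      nlinarith
  have pQ : 0 < q₀ - r * dq := by
    have : q₀ - r * dq = (1 - r) * q₀ + r * (q₀ - dq) := by ring
    rw [this]; exact affine_pos hq0 hq1
  have pA : 0 < a₀ - r * da := by
    have : a₀ - r * da = (1 - r) * a₀ + r * (a₀ - da) := by ring
    rw [this]; exact affine_pos ha0 ha1
  have pB : 0 < b₀ - r * db := by
    have : b₀ - r * db = (1 - r) * b₀ + r * (b₀ - db) := by ring
    rw [this]; exact affine_pos hb0 hb1
  have pC : 0 ≤ c₀ - r * dc := by
    have : c₀ - r * dc = (1 - r) * c₀ + r * (c₀ - dc) := by ring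
    rw [this]
    exact add_nonneg (mul_nonneg (sub_nonneg.2 hr1) hc0) (mul_nonneg hr0 hc1)
  -- `Φ(0) ≤ c₀`, `Φ(1) ≤ c₀ − dc`
  have hF0 : exp (3 * log (q₀ - 0 * dq) - 3 / 2 * log (a₀ - 0 * da) - 3 / 2 * log (b₀ - 0 * db)) ≤ c₀ := by
    refine Phi_le_of_sextic (by simpa using hq0) (by simpa using ha0) (by simpa using hb0) hc0 ?_
    simpa using h0
  have hF1 : exp (3 * log (q₀ - 1 * dq) - 3 / 2 * log (a₀ - 1 * da) - 3 / 2 * log (b₀ - 1 * db)) ≤ c₀ - dc := by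
    refine Phi_le_of_sextic (by simpa using hq1) (by simpa using ha1) (by simpa using hb1) hc1 ?_
    simpa using h1
  -- chord
  have hc := (convexOn_onePair hq0 hq1 ha0 ha1 hb0 hb1 hdq hXS).2 (left_mem_Icc.2 zero_le_one) (right_mem_Icc.2 zero_le_one)
    (sub_nonneg.2 hr1) hr0 (sub_add_cancel 1 r)
  simp only [smul_eq_mul, mul_zero, mul_one, zero_add] at hc
  -- `hc : Φ r ≤ (1 - r) * Φ 0 + r * Φ 1`
  have hFr : exp (3 * log (q₀ - r * dq) - 3 / 2 * log (a₀ - r * da) - 3 / 2 * log (b₀ - r * db)) ≤ c₀ - r * dc := by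
    have h1r : 0 ≤ 1 - r := sub_nonneg.2 hr1
    calc exp (3 * log (q₀ - r * dq) - 3 / 2 * log (a₀ - r * da) - 3 / 2 * log (b₀ - r * db))
        ≤ (1 - r) * exp (3 * log (q₀ - 0 * dq) - 3 / 2 * log (a₀ - 0 * da) - 3 / 2 * log (b₀ - 0 * db)) +
            r * exp (3 * log (q₀ - 1 * dq) - 3 / 2 * log (a₀ - 1 * da) - 3 / 2 * log (b₀ - 1 * db)) := hc
      _ ≤ (1 - r) * c₀ + r * (c₀ - dc) := add_le_add (mul_le_mul_of_nonneg_left hF0 h1r) (mul_le_mul_of_nonneg_left hF1 hr0)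
      _ = c₀ - r * dc := by ring
  -- square
  have hsq := pow_le_pow_left₀ (exp_pos _).le hFr 2
  rw [Phi_sq pQ pA pB, div_le_iff₀ (mul_pos (pow_pos pA 3) (pow_pos pB 3))] at hsq
  linarith [hsq]

/-- **`XS` from the termwise inequalities at the two endpoints.**  With `dq = dq_a + dq_b`: if `dq_a·I_a ≥ da·Q` and
`dq_b·I_b ≥ db·Q` hold at `r = 0` and at `r = 1`, they hold on `[0,1]` (affine in `r`), and imply `XS` there. [this work] -/
theorem xs_of_termwise {q₀ dqa dqb a₀ da b₀ db r : ℝ} (hr0 : 0 ≤ r) (hr1 : r ≤ 1)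
    (hA0 : 0 ≤ a₀ - r * da) (hB0 : 0 ≤ b₀ - r * db)
    (ta0 : da * q₀ ≤ dqa * a₀) (ta1 : da * (q₀ - (dqa + dqb)) ≤ dqa * (a₀ - da))
    (tb0 : db * q₀ ≤ dqb * b₀) (tb1 : db * (q₀ - (dqa + dqb)) ≤ dqb * (b₀ - db)) :
    (q₀ - r * (dqa + dqb)) * (da * (b₀ - r * db) + db * (a₀ - r * da)) ≤ (dqa + dqb) * (a₀ - r * da) * (b₀ - r * db) := by
  -- the termwise inequalities at `r`, by affinity
  have ta : da * (q₀ - r * (dqa + dqb)) ≤ dqa * (a₀ - r * da) := by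
    have e1 : da * (q₀ - r * (dqa + dqb)) = (1 - r) * (da * q₀) + r * (da * (q₀ - (dqa + dqb))) := by ring
    have e2 : dqa * (a₀ - r * da) = (1 - r) * (dqa * a₀) + r * (dqa * (a₀ - da)) := by ring
    rw [e1, e2]
    have h1r : 0 ≤ 1 - r := sub_nonneg.2 hr1
    exact add_le_add (mul_le_mul_of_nonneg_left ta0 h1r) (mul_le_mul_of_nonneg_left ta1 hr0)
  have tb : db * (q₀ - r * (dqa + dqb)) ≤ dqb * (b₀ - r * db) := by
    have e1 : db * (q₀ - r * (dqa + dqb)) = (1 - r) * (db * q₀) + r * (db * (q₀ - (dqa + dqb))) := by ring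
    have e2 : dqb * (b₀ - r * db) = (1 - r) * (dqb * b₀) + r * (dqb * (b₀ - db)) := by ring
    rw [e1, e2]
    have h1r : 0 ≤ 1 - r := sub_nonneg.2 hr1
    exact add_le_add (mul_le_mul_of_nonneg_left tb0 h1r) (mul_le_mul_of_nonneg_left tb1 hr0)
  have h1 := mul_le_mul_of_nonneg_right ta hB0
  have h2 := mul_le_mul_of_nonneg_right tb hA0
  nlinarith [h1, h2]

/-- **The `r = 1` termwise inequality follows from the `r = 0` one.**  If `da·q₀ ≤ dq_a·a₀` with `da, dq_b ≥ 0`, then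
`da·(q₀ − (dq_a + dq_b)) ≤ dq_a·(a₀ − da)` — so in `xs_of_termwise` only the two endpoint-`0` inequalities (one van den Berg–Häggström–Kahn
inequality per terminal) are ever needed (used in `…ThreePointIsoSexticUniversal`). [this work] -/
theorem termwise_one_of_zero {q₀ dqa dqb a₀ da : ℝ} (hda : 0 ≤ da) (hdqb : 0 ≤ dqb) (ta0 : da * q₀ ≤ dqa * a₀) :
    da * (q₀ - (dqa + dqb)) ≤ dqa * (a₀ - da) := by
  nlinarith [mul_nonneg hda hdqb]

end Summit.CriticalPhenomena.PercolationContinuityZ3.Theorems.ThreePointIsoSexticOnePair
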